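/-
Copyright: rh-split cell (screw, bridge) gen 15, 2026-08-27.  Splitting search over kernel-typed
RH-equivalences; this module is ζ-free analysis.  Nothing here bears on the truth of RH.
-/
import Summits.RiemannHypothesis.RiemannHypothesis.Theorems.Splittings.ScrewBorelContinuationC
import Mathlib.MeasureTheory.Integral.CircleIntegral
import Mathlib.MeasureTheory.Measure.Hausdorff
import Mathlib.MeasureTheory.Constructions.BorelSpace.Complex
import Mathlib.Topology.MetricSpace.HausdorffDimension
import Mathlib.Analysis.Normed.Group.Tannery
import HarnessLib

/-!
# Flux of a Borel series through small circles: pole walls of zero length are transparent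
(ζ-free kernel of row X-10)

Data as in `ScrewBorelContinuation`: `c : ι → ℂ` absolutely summable with `Re (c i) < 0`, `u i ≠ 0`,
the BOREL SERIES `B(z) = ∑' i, term (c i) (u i) z` and its INSIDE POLE SET `poleSet u ⊆ 𝔻`.

**Circles theorem** (`false_of_small_circles`, §4).  Let `F` be holomorphic on the unit disc and equal to
`B` on a pole-free disc `ball 0 r₀`.  Then NO inside pole `p` admits arbitrarily small circles
`sphere p R` lying in a preconnected set `V ∋ 0` with `V ⊆ 𝔻 ∖ closure (poleSet u)`.
Proof: the identity theorem gives `F = B` on `V ⊇ sphere p R`; Cauchy gives `∮_{C(p,R)} F = 0`; term by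
term (dominated convergence on the circle, §2) `∮_{C(p,R)} B = -2πi · W(R)` where
`W(R) = ∑' i, discWeight (c i) (u i) p R` is the total CHARGE `∑ (c_i/2)·q` over the poles `q` of the
series enclosed by the circle (§1: `∮ (1 - z/q)⁻¹ dz = -2πi q · [q inside]`); so `W(R) = 0` for all the
radii, while `W(R) → p · C_p` as `R → 0` (Tannery, §3) with `Re C_p < 0` (`ScrewBorel.re_poleCoeff_neg`):
contradiction.  This needs NO isolation of `p` (compare the walls theorem
`ScrewBorel.not_mem_closure_of_isolated`): the closure of the pole set must meet EVERY small circle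
around EVERY inside pole that can be linked to the origin.

**Thin walls are transparent** (`poleSet_eq_empty_of_hausdorffMeasure_zero`, §6).  If the closure of the
inside pole set has ZERO LENGTH in the disc, `μH[1] (closure (poleSet u) ∩ ball 0 1) = 0`, then the
inside pole set is EMPTY.  Indeed (§5) the distance functions `dist · a` are `1`-Lipschitz, so the set
of radii `t` for which `sphere a t` meets the closure is Lebesgue-null (`μH[1] = volume` on `ℝ`), hence
avoids a point of every interval («good radii»); three good circles and a small disc around `0` then
form the preconnected set `V` of the circles theorem.  Countable closures (row X-9) have zero length, so
this STRICTLY CONTAINS `ScrewBorel.poleSet_eq_empty`.  Dimension form: `dimH (closure (poleSet u) ∩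
ball 0 1) < 1 ⟹ poleSet u = ∅`.  The threshold is LENGTH, not AREA: the blind Wolff configuration of the
cell's barrier B16 (`ScrewLatticeWolffData.exists_wolffData`: centres of an a.e. disc packing of an annulus)
has an area-null wall which contains the packing circles, and a single circle already has positive length
(`hausdorffMeasure_sphere_pos`); whether a blinding wall can have σ-finite length / dimension exactly `1` in
the sign-definite class is left open.

RH-side reading (module `ScrewLatticeThinWall`): with Suzuki's data, «lattice generating function of
radius `1` ⟹ RH or the aliased pole field has a closure of POSITIVE LENGTH (dimension `≥ 1`)».

No `sorry`, no new axioms, no instances, no notation.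
-/

set_option linter.dupNamespace false

namespace Summit.RiemannHypothesis.RiemannHypothesis.Theorems.Splittings.ScrewBorelFlux

open Complex Filter Topology Set Metric MeasureTheory
open scoped Real ENNReal NNReal
open Summit.RiemannHypothesis.RiemannHypothesis.Theorems.Splittings.ScrewBorel

/-! ## 1. Circle integrals of the polar pieces and of one term -/

/-- `(1 - z/q)⁻¹ = -q · (z - q)⁻¹` for `q ≠ 0`. -/
theorem inv_one_sub_div_eq {q : ℂ} (hq : q ≠ 0) (z : ℂ) : (1 - z / q)⁻¹ = -q * (z - q)⁻¹ := by
  rw [one_sub_div hq, inv_div, div_eq_mul_inv, ← neg_sub z q, inv_neg]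
  ring

/-- `1 - z/q ≠ 0` unless `z = q` (`q ≠ 0`). -/
theorem one_sub_div_ne_zero {q z : ℂ} (hq : q ≠ 0) (hzq : z ≠ q) : 1 - z / q ≠ 0 := by
  intro h
  have : z / q = 1 := (sub_eq_zero.1 h).symm
  exact hzq ((div_eq_one_iff_eq hq).1 this)

/-- **Polar piece.**  For `q ≠ 0` off the circle `sphere p R` (`R > 0`):
`∮_{C(p,R)} (1 - z/q)⁻¹ dz = -2πi·q` if `‖q - p‖ < R`, and `= 0` otherwise. -/
theorem circleIntegral_inv_one_sub_div {q p : ℂ} (hq : q ≠ 0) {R : ℝ} (hR : 0 < R)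
    (hqs : q ∉ sphere p R) :
    (∮ z in C(p, R), (1 - z / q)⁻¹) = if ‖q - p‖ < R then -(2 * π * I) * q else 0 := by
  split_ifs with hin
  · have hmem : q ∈ ball p R := by rwa [mem_ball, dist_eq_norm]
    have e : EqOn (fun z : ℂ ↦ (1 - z / q)⁻¹) (fun z ↦ -q * (z - q)⁻¹) (sphere p R) :=
      fun z _ ↦ inv_one_sub_div_eq hq z
    rw [circleIntegral.integral_congr hR.le e, circleIntegral.integral_const_mul,
      circleIntegral.integral_sub_inv_of_mem_ball hmem]
    ring
  · have hne : ‖q - p‖ ≠ R := by rwa [mem_sphere, dist_eq_norm] at hqs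
    have hout : R < ‖q - p‖ := lt_of_le_of_ne (not_lt.1 hin) (Ne.symm hne)
    have hden : ∀ z ∈ closedBall p R, 1 - z / q ≠ 0 := by
      intro z hz
      refine one_sub_div_ne_zero hq fun hzq ↦ ?_
      rw [mem_closedBall, dist_eq_norm, hzq] at hz
      linarith
    have hd : ∀ z ∈ closedBall p R, DifferentiableAt ℂ (fun w : ℂ ↦ (1 - w / q)⁻¹) z :=
      fun z hz ↦ ((differentiableAt_const _).sub (differentiableAt_id.div_const q)).inv (hden z hz)
    exact circleIntegral_eq_zero_of_differentiable_on_off_countable hR.le countable_empty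
      (fun z hz ↦ (hd z hz).continuousAt.continuousWithinAt)
      (fun z hz ↦ hd z (ball_subset_closedBall hz.1))

/-- The CHARGE the term `(c, u)` puts on the disc `ball p R`: `c/2 · q` for each of its poles
`q ∈ {u⁻¹, u}` enclosed by the circle `sphere p R`. -/
noncomputable def discWeight (c u p : ℂ) (R : ℝ) : ℂ :=
  (if ‖u⁻¹ - p‖ < R then c / 2 * u⁻¹ else 0) + (if ‖u - p‖ < R then c / 2 * u else 0)

/-- **Flux of one term.**  If `closedBall p R ⊆ 𝔻` (`R > 0`) and the poles `u`, `u⁻¹` of the term are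
off the circle, then `∮_{C(p,R)} term c u = -2πi · discWeight c u p R`. -/
theorem circleIntegral_term {c u p : ℂ} (hu : u ≠ 0) {R : ℝ} (hR : 0 < R)
    (hsub : closedBall p R ⊆ ball (0 : ℂ) 1) (hus : u ∉ sphere p R) (huis : u⁻¹ ∉ sphere p R) :
    (∮ z in C(p, R), term c u z) = -(2 * π * I) * discWeight c u p R := by
  -- the pole `1` of `(1 - z)⁻¹` is outside the closed disc
  have h1s : (1 : ℂ) ∉ sphere p R := fun h ↦ by
    have := hsub (sphere_subset_closedBall h)
    rw [mem_ball_zero_iff, norm_one] at this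
    exact lt_irrefl _ this
  have h1n : ¬ ‖(1 : ℂ) - p‖ < R := fun h ↦ by
    have h1 : (1 : ℂ) ∈ closedBall p R := by rw [mem_closedBall, dist_eq_norm]; exact h.le
    have := hsub h1
    rw [mem_ball_zero_iff, norm_one] at this
    exact lt_irrefl _ this
  have I1 : (∮ z in C(p, R), (1 - z)⁻¹) = 0 := by
    have h := circleIntegral_inv_one_sub_div (p := p) one_ne_zero hR h1s
    rw [if_neg h1n] at h
    have e : (fun z : ℂ ↦ (1 - z / 1)⁻¹) = fun z ↦ (1 - z)⁻¹ := by funext z; rw [div_one]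
    rw [← e]; exact h
  have I2 : (∮ z in C(p, R), (1 - z / u)⁻¹) = if ‖u - p‖ < R then -(2 * π * I) * u else 0 :=
    circleIntegral_inv_one_sub_div hu hR hus
  have I3 : (∮ z in C(p, R), (1 - u * z)⁻¹) = if ‖u⁻¹ - p‖ < R then -(2 * π * I) * u⁻¹ else 0 := by
    have e : (fun z : ℂ ↦ (1 - u * z)⁻¹) = fun z ↦ (1 - z / u⁻¹)⁻¹ := by
      funext z; rw [div_inv_eq_mul, mul_comm]
    rw [e]; exact circleIntegral_inv_one_sub_div (inv_ne_zero hu) hR huis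
  -- integrability of the pieces on the circle (they are continuous there)
  have hzs : ∀ z ∈ sphere p R, ‖z‖ < 1 := fun z hz ↦
    mem_ball_zero_iff.1 (hsub (sphere_subset_closedBall hz))
  have c1 : CircleIntegrable (fun z : ℂ ↦ (1 - u * z)⁻¹) p R := by
    refine ContinuousOn.circleIntegrable hR.le fun z hz ↦ ?_
    have hne : 1 - u * z ≠ 0 := by
      have hzq : z ≠ u⁻¹ := fun h ↦ huis (h ▸ hz)
      have : 1 - z / u⁻¹ ≠ 0 := one_sub_div_ne_zero (inv_ne_zero hu) hzq
      rwa [div_inv_eq_mul, mul_comm] at this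
    have d : DifferentiableAt ℂ (fun w : ℂ ↦ (1 - u * w)⁻¹) z :=
      ((differentiableAt_const _).sub ((differentiableAt_const _).mul differentiableAt_id)).inv hne
    exact d.continuousAt.continuousWithinAt
  have c2 : CircleIntegrable (fun z : ℂ ↦ (1 - z / u)⁻¹) p R := by
    refine ContinuousOn.circleIntegrable hR.le fun z hz ↦ ?_
    have hne : 1 - z / u ≠ 0 := one_sub_div_ne_zero hu fun h ↦ hus (h ▸ hz)
    have d : DifferentiableAt ℂ (fun w : ℂ ↦ (1 - w / u)⁻¹) z :=
      ((differentiableAt_const _).sub (differentiableAt_id.div_const u)).inv hne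
    exact d.continuousAt.continuousWithinAt
  have c3 : CircleIntegrable (fun z : ℂ ↦ (1 - z)⁻¹) p R := by
    refine ContinuousOn.circleIntegrable hR.le fun z hz ↦ ?_
    have hne : (1 : ℂ) - z ≠ 0 := by
      intro h
      have : z = 1 := (sub_eq_zero.1 h).symm
      have := hzs z hz
      rw [‹z = 1›, norm_one] at this
      exact lt_irrefl _ this
    have d : DifferentiableAt ℂ (fun w : ℂ ↦ (1 - w)⁻¹) z :=
      ((differentiableAt_const _).sub differentiableAt_id).inv hne
    exact d.continuousAt.continuousWithinAt
  -- assemble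
  have c12 : CircleIntegrable (fun z : ℂ ↦ (1 / 2 : ℂ) * ((1 - u * z)⁻¹ + (1 - z / u)⁻¹)) p R :=
    IntervalIntegrable.const_mul (c1.add c2) (1 / 2 : ℂ)
  have e : (fun z : ℂ ↦ term c u z) =
      fun z ↦ c * ((1 / 2) * ((1 - u * z)⁻¹ + (1 - z / u)⁻¹) - (1 - z)⁻¹) := rfl
  rw [e, circleIntegral.integral_const_mul, circleIntegral.integral_sub c12 c3,
    circleIntegral.integral_const_mul, circleIntegral.integral_add c1 c2, I1, I2, I3]
  unfold discWeight
  split_ifs <;> ring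

/-! ## 2. Flux of the series: term-by-term integration on a separated circle -/

/-- **`∮ B = ∑' i, ∮ termᵢ`** on a circle `sphere p R` whose points have norm `≤ r'` and which stays
`δ`-away from the inside pole set, `0 < δ ≤ 1 - r'` (dominated convergence on `[0, 2π]` with the uniform
bound `ScrewBorel.norm_term_le`). -/
theorem hasSum_circleIntegral_borel {ι : Type*} [Countable ι] {c u : ι → ℂ}
    (hc : Summable fun i ↦ ‖c i‖) (hu : ∀ i, u i ≠ 0) {p : ℂ} {R : ℝ} (hR : 0 < R) {r' δ : ℝ}
    (hδ : 0 < δ) (hδr : δ ≤ 1 - r') (hzr : ∀ z ∈ sphere p R, ‖z‖ ≤ r')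
    (hfar : ∀ z ∈ sphere p R, ∀ q ∈ poleSet u, δ ≤ ‖q - z‖) :
    HasSum (fun i ↦ ∮ z in C(p, R), term (c i) (u i) z)
      (∮ z in C(p, R), ∑' i, term (c i) (u i) z) := by
  have hfar₁ : ∀ z ∈ sphere p R, ∀ i, ‖(u i)⁻¹‖ < 1 → δ ≤ ‖(u i)⁻¹ - z‖ :=
    fun z hz i hi ↦ hfar z hz _ ⟨hi, i, Or.inr rfl⟩
  have hfar₂ : ∀ z ∈ sphere p R, ∀ i, ‖u i‖ < 1 → δ ≤ ‖u i - z‖ :=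
    fun z hz i hi ↦ hfar z hz _ ⟨hi, i, Or.inl rfl⟩
  have hbd : ∀ z ∈ sphere p R, ∀ i, ‖term (c i) (u i) z‖ ≤ 2 * ‖c i‖ / δ :=
    fun z hz i ↦ norm_term_le (hu i) hδ hδr (hzr z hz) (hfar₁ z hz i) (hfar₂ z hz i)
  have hda : ∀ z ∈ sphere p R, ∀ i, DifferentiableAt ℂ (fun w ↦ term (c i) (u i) w) z := by
    intro z hz i
    have e1 := le_norm_one_sub_mul (hu i) hδr (hzr z hz) (hfar₁ z hz i)
    have e2 := le_norm_one_sub_div (hu i) hδr (hzr z hz) (hfar₂ z hz i)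
    have e3 := hδr.trans (one_sub_le_norm_one_sub (hzr z hz))
    have n1 : 1 - u i * z ≠ 0 := fun h ↦ by rw [h, norm_zero] at e1; linarith
    have n2 : 1 - z / u i ≠ 0 := fun h ↦ by rw [h, norm_zero] at e2; linarith
    have n3 : 1 - z ≠ 0 := fun h ↦ by rw [h, norm_zero] at e3; linarith
    exact differentiableAt_term n1 n2 n3
  have hsm : ∀ θ : ℝ, circleMap p R θ ∈ sphere p R := fun θ ↦ circleMap_mem_sphere p hR.le θ
  have hsb : Summable fun i ↦ 2 * ‖c i‖ / δ := (hc.mul_left 2).div_const δ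
  simp only [circleIntegral]
  refine intervalIntegral.hasSum_integral_of_dominated_convergence
    (fun i _ ↦ R * (2 * ‖c i‖ / δ)) (fun i ↦ ?_) (fun i ↦ ?_) ?_ ?_ ?_
  · refine Continuous.aestronglyMeasurable ?_
    have h1 : Continuous fun θ : ℝ ↦ deriv (circleMap p R) θ := by
      simp only [deriv_circleMap]; exact (continuous_circleMap 0 R).fun_mul continuous_const
    have h2 : Continuous fun θ : ℝ ↦ term (c i) (u i) (circleMap p R θ) :=
      continuous_iff_continuousAt.2 fun θ ↦
        ((hda _ (hsm θ) i).continuousAt).comp (continuous_circleMap p R).continuousAt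
    exact h1.fun_smul h2
  · refine Eventually.of_forall fun θ _ ↦ ?_
    rw [norm_smul, deriv_circleMap, norm_mul, norm_circleMap_zero, Complex.norm_I, mul_one,
      abs_of_pos hR]
    exact mul_le_mul_of_nonneg_left (hbd _ (hsm θ) i) hR.le
  · exact Eventually.of_forall fun θ _ ↦ hsb.mul_left R
  · exact intervalIntegrable_const
  · refine Eventually.of_forall fun θ _ ↦ HasSum.const_smul _ ?_
    exact (Summable.of_norm_bounded hsb (fun i ↦ hbd _ (hsm θ) i)).hasSum

/-! ## 3. The total charge on a small disc and its limit -/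

/-- `‖discWeight c u p R‖ ≤ ‖c‖` as soon as `ball p R ⊆ 𝔻`. -/
theorem norm_discWeight_le {c u p : ℂ} {R : ℝ} (hsub : ball p R ⊆ ball (0 : ℂ) 1) :
    ‖discWeight c u p R‖ ≤ ‖c‖ := by
  unfold discWeight
  have h2 : ‖c / 2‖ = ‖c‖ / 2 := by rw [norm_div]; simp
  have hq : ∀ q : ℂ, ‖q - p‖ < R → ‖c / 2 * q‖ ≤ ‖c‖ / 2 := by
    intro q hq
    have hq1 : ‖q‖ < 1 := mem_ball_zero_iff.1 (hsub (by rwa [mem_ball, dist_eq_norm]))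
    rw [norm_mul, h2]
    calc ‖c‖ / 2 * ‖q‖ ≤ ‖c‖ / 2 * 1 := by gcongr
      _ = ‖c‖ / 2 := mul_one _
  have h0 := norm_nonneg c
  refine (norm_add_le _ _).trans ?_
  split_ifs with ha hb hb
  · linarith [hq _ ha, hq _ hb]
  · rw [norm_zero]; linarith [hq _ ha]
  · rw [norm_zero]; linarith [hq _ hb]
  · rw [norm_zero]; linarith

/-- For radii below the distance from `p` to the other poles of the term, the charge of the term `(c,u)`
on `ball p R` is exactly `p · poleCoeff c u p`. -/
theorem discWeight_eq_of_small {c u p : ℂ} {R : ℝ} (hR : 0 < R)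
    (h₁ : u⁻¹ ≠ p → R ≤ ‖u⁻¹ - p‖) (h₂ : u ≠ p → R ≤ ‖u - p‖) :
    discWeight c u p R = p * poleCoeff c u p := by
  unfold discWeight poleCoeff
  have A : (if ‖u⁻¹ - p‖ < R then c / 2 * u⁻¹ else 0) = p * (if u⁻¹ = p then c / 2 else 0) := by
    by_cases h : u⁻¹ = p
    · rw [if_pos h, if_pos (by rw [h, sub_self, norm_zero]; exact hR), ← h]; ring
    · rw [if_neg h, if_neg (not_lt.2 (h₁ h)), mul_zero]
  have B : (if ‖u - p‖ < R then c / 2 * u else 0) = p * (if u = p then c / 2 else 0) := by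
    by_cases h : u = p
    · rw [if_pos h, if_pos (by rw [h, sub_self, norm_zero]; exact hR), ← h]; ring
    · rw [if_neg h, if_neg (not_lt.2 (h₂ h)), mul_zero]
  rw [A, B]; ring

/-- … hence eventually, as `R → 0⁺`. -/
theorem eventually_discWeight_eq (c u p : ℂ) :
    ∀ᶠ R in 𝓝[>] (0 : ℝ), discWeight c u p R = p * poleCoeff c u p := by
  set m : ℝ := min (if u⁻¹ = p then 1 else ‖u⁻¹ - p‖) (if u = p then 1 else ‖u - p‖) with hm
  have hm0 : 0 < m := by
    rw [hm]
    refine lt_min ?_ ?_ <;> split_ifs with h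
    · exact one_pos
    · exact norm_pos_iff.2 (sub_ne_zero.2 h)
    · exact one_pos
    · exact norm_pos_iff.2 (sub_ne_zero.2 h)
  filter_upwards [Ioo_mem_nhdsGT hm0] with R hR
  refine discWeight_eq_of_small hR.1 (fun h ↦ ?_) (fun h ↦ ?_)
  · have := hR.2.le.trans (min_le_left _ _); rwa [if_neg h] at this
  · have := hR.2.le.trans (min_le_right _ _); rwa [if_neg h] at this

/-- **Limit of the total charge.**  For `‖p‖ < 1`,
`∑' i, discWeight (c i) (u i) p R ⟶ ∑' i, p · poleCoeff (c i) (u i) p` as `R → 0⁺` (Tannery). -/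
theorem tendsto_tsum_discWeight {ι : Type*} {c : ι → ℂ} (u : ι → ℂ) (hc : Summable fun i ↦ ‖c i‖)
    {p : ℂ} (hp : ‖p‖ < 1) :
    Tendsto (fun R : ℝ ↦ ∑' i, discWeight (c i) (u i) p R) (𝓝[>] 0)
      (𝓝 (∑' i, p * poleCoeff (c i) (u i) p)) := by
  refine tendsto_tsum_of_dominated_convergence (bound := fun i ↦ ‖c i‖) hc (fun i ↦ ?_) ?_
  · exact tendsto_const_nhds.congr'
      ((eventually_discWeight_eq (c i) (u i) p).mono fun R h ↦ h.symm)
  · filter_upwards [Ioo_mem_nhdsGT (show (0 : ℝ) < 1 - ‖p‖ by linarith)] with R hR i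
    refine norm_discWeight_le fun z hz ↦ ?_
    rw [mem_ball, dist_eq_norm] at hz
    rw [mem_ball_zero_iff]
    calc ‖z‖ = ‖p + (z - p)‖ := by congr 1; ring
      _ ≤ ‖p‖ + ‖z - p‖ := norm_add_le _ _
      _ < 1 := by linarith [hR.2]

end Summit.RiemannHypothesis.RiemannHypothesis.Theorems.Splittings.ScrewBorelFlux
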